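import Literature.MathematicalPhysics.QuantumFieldTheory.Balaban1983to89.B9Eq3126H1kTwoBackgroundSupRowsTower
import Literature.MathematicalPhysics.QuantumFieldTheory.Balaban1983to89.B11Eq117ReadLettersBridge
import Literature.MathematicalPhysics.QuantumFieldTheory.Balaban1983to89.B11Eq117LetterDefects

/-!
# `Balaban1983to89.B11Eq117H1kLetterDefectAtFlatLatticeFree` — T. Bałaban, *The variational problem and background fields in renormalization group method for lattice gauge
# theories*, Commun. Math. Phys. **102** (1985) 277–309 [Balaban1985Variational] (115)∕(117) pp. 294–295 *«By Theorem 3.13 of [5] the norm max{|·|_{(−1)}, |∇·|_{(−2)}} of the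
# transformation can be estimated by B₀|J|_{(−3)} + …»*, (103) p. 293, (45) p. 285, with [Balaban1985BackgroundPropagators] Thm 3.4 p. 400, (3.126) p. 420, (3.133) p. 422,
# (3.3) p. 391: **THE `H₁`-LETTER DEFECT `δ_A` OF THE `k`-LEVEL CHART AT THE FLAT POINT, LATTICE-FREE — `‖ι(H₁,k(U)B) − H₁,k(1)B‖_(115),∇_1 ≤
# max(w̄₀, w̄₁)·M_φ·K·α·M_φ′·w̲_B⁻¹·‖B‖_(−0)` with `K` BEFORE `n, η, m, U`, and the jet identity `‖ι_{∇_U→∇_1}‖ ≤ 1 + w̄₁·2α·w̲₀⁻¹`** — the (δ_A)- and (K_ι)-members of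
# ne9-leaf-04's fixed-lattice `B11Eq117LetterDefectsTowerTwoBackgrounds.exists_letter_defects_tower_two_backgrounds_closed` (whose (117) product carries `2|η|⁻¹ = 2L^{n+1}` and
# `√(c₁·#bonds)`) at `V := 1`, with the product replaced by the level weights alone: the sup → sup rows of gen 101's `H₁,k`-storey
# (`B9Eq3126H1kTwoBackgroundSupRowsTower`) fed through the owner's socket `B11Eq117ReadLettersBridge.norm_H1CLM_le_of_global`

statement-level skeleton of published theorems with citation tags; proofs where landed; nothing here is a claim about the Yang–Mills mass gap

CITATION HEADER (lean-in-tree rule).  Audit cell `pub-balaban`, sub-cell `t4`, BINDER row NE9; filed by NE9 crux-team LEAF PROVER 01 (`b2b-balaban-t4-ne9-formalise-leaf-01`, gen 101;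
ROUTE (J′), junction of the `H₁` storey with (117); bears_on: R4/N22).  Composition BY NAME: this lineage's gen-101 `B9Eq3126H1kTwoBackgroundSupRowsTower.exists_supRows_H1k_sub_flat`;
the OWNER's `B11Eq117ReadLettersBridge.norm_H1CLM_le_of_global` (the (103)∕(117) socket for block letters from global value + gradient rows), `B11Eq117LetterDefects.{norm_jetId_le,
norm_nabla115_sub_flat_le, readFun_sub}`, `B11Eq103H1Complex.{H1LatticeCLM, H1CLM, blockCLM115_apply}`, `B9Eq326OperatorTower.H1k` (`= H1LatticeK hpos (QkW_surjective …)`, so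
`H1LatticeK hposU hQU = H1k … hαL hposU` by proof irrelevance).  Source READ first-hand in the held text layer `paper:balaban1985-cmp102-variational-background` (journal page = PDF
page + 276) p. 295 (117), p. 293 (103); `paper:balaban1985-cmp99-background-propagators` p. 400 Thm 3.4, p. 422 (3.133).  NOTHING of print's proofs is reproduced: [folklore] bookkeeping.

WHAT IS PROVED (sorry-free; proof lane — 0 `def`; [folklore]).
* **`exists_H1k_letterDefect_at_flat_latticeFree`** — `∃ α₀ > 0, K ≥ 0` BEFORE `n, η, c₀, c₁, m`, ANY level maps `lev₀, lev_B, lev₁`, every background `U` of the bond storey's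
  class (`+ hαL`, ANY onto-witnesses `hQU`, `hQ1`), then (K_ι) `‖ι f‖ ≤ (1 + w̄₁·(2α)·w̲₀⁻¹)·‖f‖` for every `f : Space115(∇_U)` and (δ_A) for every block field `B : NegSize lev_B 0`:
  `‖ι(H1LatticeCLM_U B) − H1LatticeCLM_1 B‖ ≤ max(w̄₀·(M_φ(Kα)M_φ′), w̄₁·(M_φ(Kα)M_φ′))·w̲_B⁻¹·‖B‖` — NO `|η|⁻¹`, NO bond count: at the top-level profile
  (`w̄₀ = w̄₁ = w̲_B⁻¹ = 1`) the defect is `M_φM_φ′·K·α·‖B‖`.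
HONEST SCOPE.  Bookkeeping BY NAME on the cell's MODEL rows (O-NE9-1, #5 UNRULED); constants crude (NOT print's `B₀`); FIRST order AT THE FLAT POINT only (not between two general
backgrounds); the `H₁`-member only (the `𝔊`-member `δ_G` needs the `𝔊_k` storey — successor work); the level weights stay DISPLAYED (`w̄₀`, `w̄₁`, `w̲_B`); the smallness windows of `U`,
unitarity, the tower data, `hαL`, the positivity and onto witnesses stay HYPOTHESES; nothing of [B11] (117) or [B9] Thm 3.4 ∕ (3.133) asserted as printed; «NE9 ⇐ the named binders»; NE9
NOT PRINTED ∕ NOT PROVED; spine PROVED 0∕9; rung (B)+1 on a finite T⁴ — NOT infinite volume, NOT mass gap, NOT BetaPertH, NOT Clay.  HONEST DEPENDENCY: continuum YM on T⁴ ⇐ BetaPertH ∧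
nine spine estimates (0/9 proved); BetaPertH ⇐ (D1) ∧ (D4) ∧ CAP+tail; G-an2-4 gates asym, D1 and NE2/3/4.  NEW file; nothing modified.  Net new unproved facts: 0.
-/

noncomputable section

open scoped InnerProductSpace ComplexConjugate BigOperators

namespace Literature.MathematicalPhysics.QuantumFieldTheory.Balaban1983to89.B11Eq117H1kLetterDefectAtFlatLatticeFree

open B4Sect5Torus (TSite)
open B9SectCLatticeCarrier (Bond bpos shift unshift)
open B9Eq311L2Pairing (WL2)
open B7Prop1Explicit (U1 Wcx boxVec)
open B11Eq103H1Complex (SiteL2K BondL2K H1LatticeK H1LatticeCLM H1CLM blockCLM115_apply readFun)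
open B11Eq115Space (NegSize Space115 levWeight NegSup JetSup)
open B11Eq111FrakG (nabla115 jetLinearEquiv)
open B9Eq33CovDerivVector (covGrad)
open B9Eq310DeltaPrime (plaqHolU)
open B9Eq310HessianOperator (adTransportW hessOp)
open B9Eq315QTorus (perCfg cornerSite)
open B9Eq315QTower (towerP UlevOf)
open B9Eq315QTowerFlat (perCfg_UlevOf_one_mem_U1 norm_Wcx_UlevOf_one_sub_one_le)
open B9Eq326OperatorTower (laplaceAk H1k QkW RofUk)
open B9Eq324DeltaPrimeATower (laplacePrimeAk)
open B11Eq117LetterDefects (norm_jetId_le norm_nabla115_sub_flat_le readFun_sub)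
open B11Eq117ReadLettersBridge (norm_H1CLM_le_of_global)
open B9Eq3126H1kTwoBackgroundSupRowsTower (exists_supRows_H1k_sub_flat)

variable {d : ℕ} (hd : 1 ≤ d) (L : ℕ) [NeZero L] (hL : 1 ≤ L) (hL3 : 3 ≤ L)
  {𝔸 : Type*} [NormedRing 𝔸] [NormedAlgebra ℂ 𝔸] [CompleteSpace 𝔸] [NormOneClass 𝔸] [StarRing 𝔸] [NormedStarGroup 𝔸] [StarModule ℂ 𝔸] [FiniteDimensional ℂ 𝔸]
  {W : Type*} [NormedAddCommGroup W] [InnerProductSpace ℂ W] [FiniteDimensional ℂ W] (φ : W ≃ₗ[ℂ] 𝔸)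
  {Mφ Mφ' : ℝ} (hMφ : 0 ≤ Mφ) (hMφ' : 0 ≤ Mφ') (hφ : ∀ w, ‖φ w‖ ≤ Mφ * ‖w‖) (hφ' : ∀ X, ‖φ.symm X‖ ≤ Mφ' * ‖X‖) (hstar : ∀ X : 𝔸, ‖star X‖ ≤ ‖X‖)
  {a : ℝ} (ha : 0 < a) {a' : ℝ} (ha' : 0 < a') {r : ℝ} (hr0 : 0 ≤ r) (hr1 : r < 1)
  (τ : 𝔸 →ₗ[ℂ] ℂ) {Cτ : ℝ} (hτ : ∀ X, ‖τ X‖ ≤ Cτ * ‖X‖) (hCτ : 0 ≤ Cτ) {Mτ : ℝ} (hτm : ∀ X Y : 𝔸, ‖τ (X * Y)‖ ≤ Mτ * ‖X‖ * ‖Y‖) (hMτ : 0 ≤ Mτ)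
  {ρw : ℝ} (hρw : 0 ≤ ρw)
  (hτ₁ : ∀ X : 𝔸, τ (star X) = conj (τ X)) (hτ₂ : ∀ X Y : 𝔸, τ (X * Y) = τ (Y * X)) (hφτ : ∀ X Y : 𝔸, ⟪φ.symm X, φ.symm Y⟫_ℂ = τ (star X * Y))
  {ι : Type} [Fintype ι] [DecidableEq ι] (b : Module.Basis ι ℝ 𝔸) {M₂ : ℝ} (hM₂ : 0 ≤ M₂) (hrepr : ∀ (v : 𝔸) (i : ι), |b.repr v i| ≤ M₂ * ‖v‖)
  (AQ : ℝ)

/-! ## The `H₁`-letter defect and the jet identity at the flat point, lattice-free -/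

include hd hL hL3 hMφ hMφ' hφ hφ' hstar ha ha' hr0 hr1 hτ hCτ hτm hMτ hρw hτ₁ hτ₂ hφτ hM₂ hrepr in
set_option maxHeartbeats 3200000 in
set_option maxRecDepth 8192 in
/-- **THE `H₁`-LETTER DEFECT `δ_A` AND THE JET IDENTITY `K_ι` OF THE `k`-LEVEL CHART AT THE FLAT POINT, LATTICE-FREE** — see the module docstring. [folklore]
[cite: Balaban1985Variational, (115) p.294, (117) p.295, (103) p.293, (45) p.285; Balaban1985BackgroundPropagators, Thm 3.4 p.400, (3.126) p.420, (3.133) p.422, (3.3) p.391] -/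
theorem exists_H1k_letterDefect_at_flat_latticeFree [Fact (0 < (L : ℝ))] :
    ∃ α₀ K : ℝ, 0 < α₀ ∧ 0 ≤ K ∧
      ∀ (n : ℕ) (η : ℝ) [Fact (0 < η)], η * (L : ℝ) ^ (n + 1) = 1 →
      ∀ (c₀ c₁ : ℝ) [Fact (0 < c₀)] [Fact (0 < c₁)], c₀ * ((L : ℝ) ^ (n + 1)) ^ d = c₁ → |η| ^ d / c₀ ≤ ρw →
      ∀ (m : Fin d → ℕ) [∀ i, NeZero (m i)], (∀ i, 1 ≤ m i) → ∀ (U : Bond d (towerP L m (n + 1)) → 𝔸ˣ) (α : ℝ), 0 ≤ α → α ≤ α₀ →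
        (∀ bd, U bd ∈ U1 𝔸) → (∀ bd, ‖(U bd : 𝔸) - 1‖ ≤ α * η) →
        (∀ (x : TSite d (towerP L m (n + 1))) (μ ν : Fin d), ‖(U (shift ν x, μ) : 𝔸) - (U (x, μ) : 𝔸)‖ ≤ α * η ^ 2) →
        (∀ p : B9SectCLatticeCarrier.Plaq d (towerP L m (n + 1)), ‖(plaqHolU U p : 𝔸) - 1‖ ≤ α * η ^ 2) →
      ∀ (hUst : ∀ bd, star (U bd : 𝔸) = (((U bd)⁻¹ : 𝔸ˣ) : 𝔸))
        (αU : ℕ → ℝ), (∀ j, 0 ≤ αU j) → ∀ (hα1 : ∀ j, αU j ≤ 1 / 64), ∀ (hαL : ∀ j, 50 * (d + 1) * αU j * (L : ℝ) ^ d ≤ 1 / 2),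
        (∑ j ∈ Finset.range (n + 1), αU j ≤ AQ) →
        ∀ (hU1 : ∀ (j : ℕ) (x : B7Prop1Explicit.Site d) (k : Fin d), perCfg (towerP L m (j + 1)) (UlevOf L m (n + 1) U j) x k ∈ U1 𝔸)
        (hreg : ∀ (j : ℕ) (y : TSite d (towerP L m j)) (k : Fin d) (ρ' : Fin d → Fin L),
          ‖((Wcx L (perCfg (towerP L m (j + 1)) (UlevOf L m (n + 1) U j)) (cornerSite L y) k (boxVec L ρ') : 𝔸ˣ) : 𝔸) - 1‖ ≤ αU j),
      ∀ (εU : ℕ → ℝ), (∀ j, 0 ≤ εU j) → (∀ j, εU j ≤ 1) → (∀ j < n + 1, εU j ≤ α * r ^ j) →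
        (∀ (j : ℕ) (bd : Bond d (towerP L m (j + 1))), ‖(UlevOf L m (n + 1) U j bd : 𝔸) - 1‖ ≤ εU j) →
        (∀ (j : ℕ) (bd : Bond d (towerP L m (j + 1))), UlevOf L m (n + 1) U j bd ∈ U1 𝔸) →
        (∀ (j : ℕ) (bd : Bond d (towerP L m (j + 1))) (w : W), ‖adTransportW φ (UlevOf L m (n + 1) U j) bd w‖ ≤ ‖w‖) →
      ∀ (hposU' : ∀ x : SiteL2K ℂ d (towerP L m (n + 1)) c₀ W, x ≠ 0 → 0 < RCLike.re ⟪x, laplacePrimeAk L m n φ η U a' (c₁ := c₁) x⟫_ℂ)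
        (hposU : ∀ x : BondL2K ℂ d (towerP L m (n + 1)) c₀ W, x ≠ 0 →
          0 < RCLike.re ⟪x, laplaceAk L m n φ η U hL αU hα1 hU1 hreg τ (c₀ := c₀) (c₁ := c₁) a x⟫_ℂ)
        (hpos'₁ : ∀ x : SiteL2K ℂ d (towerP L m (n + 1)) c₀ W, x ≠ 0 →
          0 < RCLike.re ⟪x, laplacePrimeAk L m n φ η (fun _ : Bond d (towerP L m (n + 1)) => (1 : 𝔸ˣ)) a' (c₁ := c₁) x⟫_ℂ)
        (hpos₁ : ∀ x : BondL2K ℂ d (towerP L m (n + 1)) c₀ W, x ≠ 0 →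
          0 < RCLike.re ⟪x, laplaceAk L m n φ η (fun _ : Bond d (towerP L m (n + 1)) => (1 : 𝔸ˣ)) hL (fun _ => 0) (fun _ => by norm_num)
            (perCfg_UlevOf_one_mem_U1 L m (n + 1)) (norm_Wcx_UlevOf_one_sub_one_le L m (n + 1) (fun _ => 0) (fun _ => le_rfl)) τ
            (c₀ := c₀) (c₁ := c₁) a x⟫_ℂ),
      ∀ (hQU : Function.Surjective (QkW L m n φ U hL αU hα1 hU1 hreg (c₀ := c₀) (c₁ := c₁)))
        (hQ1 : Function.Surjective (QkW L m n φ (fun _ : Bond d (towerP L m (n + 1)) => (1 : 𝔸ˣ)) hL (fun _ => 0) (fun _ => by norm_num)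
          (perCfg_UlevOf_one_mem_U1 L m (n + 1)) (norm_Wcx_UlevOf_one_sub_one_le L m (n + 1) (fun _ => 0) (fun _ => le_rfl)) (c₀ := c₀) (c₁ := c₁)))
        (lev₀ : Bond d (towerP L m (n + 1)) → ℕ) (levB : Bond d m → ℕ) (lev₁ : Bond d (towerP L m (n + 1)) × Fin d → ℕ),
        -- (K_ι) the jet identity `∇_U → ∇_1`, height-free
        (∀ f : Space115 (L : ℝ) η lev₀ lev₁ (nabla115 η U),
          ‖LinearMap.toContinuousLinearMap
              ((jetLinearEquiv (L : ℝ) η lev₀ lev₁ (nabla115 η (fun _ : Bond d (towerP L m (n + 1)) => (1 : 𝔸ˣ)))).symm.toLinearMap ∘ₗ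
                (jetLinearEquiv (L : ℝ) η lev₀ lev₁ (nabla115 η U)).toLinearMap) f‖ ≤
            (1 + (NegSup.wSup (levWeight (L : ℝ) η lev₁ 2) : ℝ) * (2 * α) * NegSup.wInvSup (levWeight (L : ℝ) η lev₀ 1)) * ‖f‖) ∧
        -- (δ_A) the `H₁`-letter across the two norms, height- and volume-free
        (∀ B : NegSize (L : ℝ) η levB 0 𝔸,
          ‖LinearMap.toContinuousLinearMap
              ((jetLinearEquiv (L : ℝ) η lev₀ lev₁ (nabla115 η (fun _ : Bond d (towerP L m (n + 1)) => (1 : 𝔸ˣ)))).symm.toLinearMap ∘ₗ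
                (jetLinearEquiv (L : ℝ) η lev₀ lev₁ (nabla115 η U)).toLinearMap)
              (H1LatticeCLM (L := (L : ℝ)) (η := η) (lev₀ := lev₀) (levB := levB) φ hposU hQU lev₁ (nabla115 η U) B) -
            H1LatticeCLM (L := (L : ℝ)) (η := η) (lev₀ := lev₀) (levB := levB) (c := ((η : ℂ))⁻¹)
              (R := adTransportW φ (fun _ : Bond d (towerP L m (n + 1)) => (1 : 𝔸ˣ)))
              (S := adTransportW φ fun _ : Bond d (towerP L m (n + 1)) => (1 : 𝔸ˣ)⁻¹) (Δ₁ := hessOp φ η (fun _ : Bond d (towerP L m (n + 1)) => (1 : 𝔸ˣ)) τ)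
              (Rr := RofUk L m n φ η (fun _ : Bond d (towerP L m (n + 1)) => (1 : 𝔸ˣ)))
              (Q := (QkW L m n φ (fun _ : Bond d (towerP L m (n + 1)) => (1 : 𝔸ˣ)) hL (fun _ => 0) (fun _ => by norm_num)
                (perCfg_UlevOf_one_mem_U1 L m (n + 1)) (norm_Wcx_UlevOf_one_sub_one_le L m (n + 1) (fun _ => 0) (fun _ => le_rfl)) (c₀ := c₀) (c₁ := c₁))) (a := a)
              φ hpos₁ hQ1 lev₁ (nabla115 η (fun _ : Bond d (towerP L m (n + 1)) => (1 : 𝔸ˣ))) B‖ ≤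
            max ((NegSup.wSup (levWeight (L : ℝ) η lev₀ 1) : ℝ) * (Mφ * (K * α) * Mφ')) (NegSup.wSup (levWeight (L : ℝ) η lev₁ 2) * (Mφ * (K * α) * Mφ')) *
              NegSup.wInvSup (levWeight (L : ℝ) η levB 0) * ‖B‖) := by
  classical
  obtain ⟨α₀, K, hα₀, hK, H⟩ :=
    exists_supRows_H1k_sub_flat hd L hL hL3 φ hMφ hMφ' hφ hφ' hstar ha ha' hr0 hr1 τ hτ hCτ hτm hMτ hρw hτ₁ hτ₂ hφτ b hM₂ hrepr AQ
  refine ⟨α₀, K, hα₀, hK, ?_⟩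
  intro n η _ hηL c₀ c₁ _ _ hw hρ m _ hm U α hα hαle hUb hUη hUw hpl hUst αU hα0U hα1 hαL hAQ hU1 hreg εU hε0 hε1 hεr hlev hlev1 hRlev hposU' hposU hpos'₁ hpos₁
    hQU hQ1 lev₀ levB lev₁
  obtain ⟨hT, hDT⟩ := H n η hηL c₀ c₁ hw hρ m hm U α hα hαle hUb hUη hUw hpl hUst αU hα0U hα1 hαL hAQ hU1 hreg εU hε0 hε1 hεr hlev hlev1 hRlev hposU' hposU hpos'₁ hpos₁
  have hη : 0 < η := Fact.out
  have hcn : ‖((η : ℂ))⁻¹‖ = η⁻¹ := by rw [norm_inv, Complex.norm_real, Real.norm_eq_abs, abs_of_pos hη]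
  have hKα : 0 ≤ K * α := mul_nonneg hK hα
  refine ⟨fun f => ?_, fun B => ?_⟩
  · -- (K_ι): `‖∇_1 − ∇_U‖ ≤ 2|η|⁻¹(αη) = 2α`
    have h := norm_jetId_le (L := (L : ℝ)) (η := η) (lev₀ := lev₀) lev₁ (nabla115 η U) (nabla115 η fun _ : Bond d (towerP L m (n + 1)) => (1 : 𝔸ˣ))
      (by positivity) (norm_nabla115_sub_flat_le η U hUb (by positivity) hUη) f
    have e : 2 * ‖((η : ℂ))⁻¹‖ * (α * η) = 2 * α := by rw [hcn]; field_simp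
    rw [e] at h
    exact h
  · -- (δ_A): the two letters are `H1CLM φ (∇_1) (H₁,k(U))` and `H1CLM φ (∇_1) (H₁,k(1))`; their difference is `H1CLM φ (∇_1) (H₁,k(U) − H₁,k(1))`
    set HU := H1k L m n φ η U hL αU hα1 hU1 hreg τ (c₀ := c₀) (c₁ := c₁) hαL hposU with hHU
    set H1 := H1k L m n φ η (fun _ : Bond d (towerP L m (n + 1)) => (1 : 𝔸ˣ)) hL (fun _ => 0) (fun _ => by norm_num)
                (perCfg_UlevOf_one_mem_U1 L m (n + 1)) (norm_Wcx_UlevOf_one_sub_one_le L m (n + 1) (fun _ => 0) (fun _ => le_rfl)) τ (c₀ := c₀) (c₁ := c₁)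
                (fun _ => by norm_num) hpos₁ with hH1
    have e1 : LinearMap.toContinuousLinearMap
            ((jetLinearEquiv (L : ℝ) η lev₀ lev₁ (nabla115 η (fun _ : Bond d (towerP L m (n + 1)) => (1 : 𝔸ˣ)))).symm.toLinearMap ∘ₗ
              (jetLinearEquiv (L : ℝ) η lev₀ lev₁ (nabla115 η U)).toLinearMap)
            (H1LatticeCLM (L := (L : ℝ)) (η := η) (lev₀ := lev₀) (levB := levB) φ hposU hQU lev₁ (nabla115 η U) B) =
        H1CLM (L := (L : ℝ)) (η := η) (lev₀ := lev₀) (levB := levB) φ lev₁ (nabla115 η (fun _ : Bond d (towerP L m (n + 1)) => (1 : 𝔸ˣ))) HU B := rfl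
    have e2 : H1LatticeCLM (L := (L : ℝ)) (η := η) (lev₀ := lev₀) (levB := levB) (c := ((η : ℂ))⁻¹)
              (R := adTransportW φ (fun _ : Bond d (towerP L m (n + 1)) => (1 : 𝔸ˣ)))
              (S := adTransportW φ fun _ : Bond d (towerP L m (n + 1)) => (1 : 𝔸ˣ)⁻¹) (Δ₁ := hessOp φ η (fun _ : Bond d (towerP L m (n + 1)) => (1 : 𝔸ˣ)) τ)
              (Rr := RofUk L m n φ η (fun _ : Bond d (towerP L m (n + 1)) => (1 : 𝔸ˣ)))
              (Q := (QkW L m n φ (fun _ : Bond d (towerP L m (n + 1)) => (1 : 𝔸ˣ)) hL (fun _ => 0) (fun _ => by norm_num)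
                (perCfg_UlevOf_one_mem_U1 L m (n + 1)) (norm_Wcx_UlevOf_one_sub_one_le L m (n + 1) (fun _ => 0) (fun _ => le_rfl)) (c₀ := c₀) (c₁ := c₁))) (a := a)
              φ hpos₁ hQ1 lev₁ (nabla115 η (fun _ : Bond d (towerP L m (n + 1)) => (1 : 𝔸ˣ))) B =
        H1CLM (L := (L : ℝ)) (η := η) (lev₀ := lev₀) (levB := levB) φ lev₁ (nabla115 η (fun _ : Bond d (towerP L m (n + 1)) => (1 : 𝔸ˣ))) H1 B := rfl
    have e3 : H1CLM (L := (L : ℝ)) (η := η) (lev₀ := lev₀) (levB := levB) φ lev₁ (nabla115 η (fun _ : Bond d (towerP L m (n + 1)) => (1 : 𝔸ˣ))) HU B -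
          H1CLM (L := (L : ℝ)) (η := η) (lev₀ := lev₀) (levB := levB) φ lev₁ (nabla115 η (fun _ : Bond d (towerP L m (n + 1)) => (1 : 𝔸ˣ))) H1 B =
        H1CLM (L := (L : ℝ)) (η := η) (lev₀ := lev₀) (levB := levB) φ lev₁ (nabla115 η (fun _ : Bond d (towerP L m (n + 1)) => (1 : 𝔸ˣ))) (HU - H1) B := by
      unfold H1CLM
      apply (JetSup.equiv _ _ (nabla115 η (fun _ : Bond d (towerP L m (n + 1)) => (1 : 𝔸ˣ)))).injective
      rw [JetSup.equiv_sub, blockCLM115_apply, blockCLM115_apply, blockCLM115_apply, readFun_sub, LinearMap.sub_apply]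
    rw [e1, e2, e3]
    have hop := norm_H1CLM_le_of_global (Lw := (L : ℝ)) (ηw := η) (lev₀ := lev₀) (levB := levB) φ hMφ hφ hMφ' hφ' η
      (fun _ : Bond d (towerP L m (n + 1)) => (1 : 𝔸ˣ)) lev₁ (HU - H1) hKα hKα hT hDT
    exact (ContinuousLinearMap.le_opNorm _ _).trans (mul_le_mul_of_nonneg_right hop (norm_nonneg _))

end Literature.MathematicalPhysics.QuantumFieldTheory.Balaban1983to89.B11Eq117H1kLetterDefectAtFlatLatticeFree

end
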